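import Summits.AnomalousDissipation.AnomalousDissipation.Theorems.SolenoidalFractalHomogenisationLagrangianCarrierConstructionTowerStepSmooth
import HarnessLib

/-!
# K3L `LagrangianCarrierConstruction` (stmt-AnomalousDissipation-24913), line `birth`, stub `stub_flowsL`:
# the inductive step of the Lagrangian tower, EXPLICIT form (helper; `--supports stmt-AnomalousDissipation-24913`)

Summits-side helper file (everything proved; no definitions, no named facts). `tower_step_explicit` is `…TowerStepSmooth.tower_step_smooth` with
the witnesses exposed: the Eulerian evolution `Z`, the accumulated window maps `C` (any solution of the accumulation recursion) and the next absolute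
flow `A'` / break set `D'` are PARAMETERS constrained by their defining equations, so that further properties of the same next flow (time
periodicity, measure preservation, …) can be proved in separate files and combined with the invariant at assembly time. The invariant has the
smoothness clauses of the tower invariant quantified over ALL finite orders `n ≥ 1` (one-sided joint `C^n` slabs of the absolute flow and
of its inverses at every time; two-sided ones off the countable break set, which now also collects, for every order, the times around which
the Eulerian field has no two-sided `C^n` slab): the SAME next absolute flow `A'` is produced for all orders, so that its slices are `C^∞`
(`Torus.IsSmooth` after descent) — what the per-level regularity package `LevelRegular` of the re-registered `stub_flowsL` asks. The
flow equation, the inserted velocity and the derivative bounds are those of order one. Infrastructure for the construction side of route-1's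
rung leaf F-D1.A0 (a frontier formal rung); NOT a proof of anomalous dissipation.
-/

set_option linter.dupNamespace false

noncomputable section

namespace Summit.AnomalousDissipation.AnomalousDissipation.Theorems.SolenoidalFractalHomogenisation.LagrangianCarrierConstruction

open Set Function Filter Topology Metric
open scoped NNReal
open Literature.Analysis.ODE Literature.Analysis.FunctionSpaces

section Step

variable {d : Type*} [Fintype d] [DecidableEq d]

/-- **The inductive step of the Lagrangian tower, explicit form** (see the module docstring). [cite: ArmstrongVicol2025, §2.2 (PDF pp. 12, 18: the Lagrangian flows X_m and the insertion on refresh windows)] -/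
theorem tower_step_explicit
    (A : ℝ → EuclideanSpace ℝ d ≃ EuclideanSpace ℝ d) (B : ℝ → EuclideanSpace ℝ d → EuclideanSpace ℝ d) (D : Set ℝ)
    (h1 : ∀ t z (k : d → ℤ), A t (z + Torus.latticeVec k) = A t z + Torus.latticeVec k)
    (h3 : ∀ (n : ℕ), 1 ≤ n → ∀ r, ∃ ε > 0, ContDiffOn ℝ n (fun p : ℝ × EuclideanSpace ℝ d => A p.1 p.2) (Icc r (r + ε) ×ˢ univ) ∧
      ContDiffOn ℝ n (fun p : ℝ × EuclideanSpace ℝ d => A p.1 p.2) (Icc (r - ε) r ×ˢ univ))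
    (h3' : ∀ (n : ℕ), 1 ≤ n → ∀ r, ∃ ε > 0, ContDiffOn ℝ n (fun p : ℝ × EuclideanSpace ℝ d => (A p.1).symm p.2) (Icc r (r + ε) ×ˢ univ) ∧
      ContDiffOn ℝ n (fun p : ℝ × EuclideanSpace ℝ d => (A p.1).symm p.2) (Icc (r - ε) r ×ˢ univ))
    (h4 : D.Countable)
    (h4a : ∀ (n : ℕ), 1 ≤ n → ∀ t ∉ D, ∃ ε > 0, ContDiffOn ℝ n (fun p : ℝ × EuclideanSpace ℝ d => A p.1 p.2) (Icc (t - ε) (t + ε) ×ˢ univ))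
    (h4b : ∀ (n : ℕ), 1 ≤ n → ∀ t ∉ D, ∃ ε > 0, ContDiffOn ℝ n (fun p : ℝ × EuclideanSpace ℝ d => (A p.1).symm p.2)
      (Icc (t - ε) (t + ε) ×ˢ univ))
    (h5 : ∀ t ∉ D, ∀ z, HasDerivAt (fun τ => A τ z) (B t (A t z)) t)
    (h7a : ∀ t z (k : d → ℤ), B t (z + Torus.latticeVec k) = B t z)
    (h7b : ∀ a b : ℝ, ∃ C : ℝ, ∀ t ∈ Icc a b, ∀ z, ‖B t z‖ ≤ C)
    (h7c : ∀ t ∉ D, ∀ z, ContinuousAt (uncurry B) (t, z))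
    (h8 : ∀ a b : ℝ, ∃ K : ℝ, ∀ t ∈ Icc a b, ∀ z, ‖fderiv ℝ (A t) z‖ ≤ K)
    (h8' : ∀ a b : ℝ, ∃ K : ℝ, ∀ t ∈ Icc a b, ∀ z, ‖fderiv ℝ (fun y => (A t).symm y) z‖ ≤ K)
    (v : ℝ → EuclideanSpace ℝ d → EuclideanSpace ℝ d) (hv : IsUniformlyLipschitzOn v univ)
    (hvper : ∀ t z (k : d → ℤ), v t (z + Torus.latticeVec k) = v t z)
    (hvloc : ∀ (n : ℕ), 1 ≤ n → ∀ r, ∃ ε > 0, ContDiffOn ℝ n (uncurry v) (Icc r (r + ε) ×ˢ univ) ∧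
      ContDiffOn ℝ n (uncurry v) (Icc (r - ε) r ×ˢ univ))
    (hvbdd : ∃ C : ℝ, ∀ t z, ‖v t z‖ ≤ C)
    (R : ℝ) (hR : 0 < R)
    (Z : ℝ → ℝ → EuclideanSpace ℝ d ≃ EuclideanSpace ℝ d) (hZ : ∀ t s z, Z t s z = evolutionMap v s t z)
    (hZ' : ∀ t s z, (Z t s).symm z = evolutionMap v t s z)
    (C : ℤ → EuclideanSpace ℝ d ≃ EuclideanSpace ℝ d) (hC0 : C 0 = Equiv.refl _)
    (hC : ∀ j : ℤ, C (j + 1) = (C j).trans ((Z (((j : ℝ) + 1) * R) ((j : ℝ) * R)).trans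
      ((A ((j : ℝ) * R)).symm.trans (A (((j : ℝ) + 1) * R)))))
    (A' : ℝ → EuclideanSpace ℝ d ≃ EuclideanSpace ℝ d)
    (hA'def : ∀ t, A' t = (C ⌊t / R⌋).trans ((Z t ((⌊t / R⌋ : ℝ) * R)).trans ((A ((⌊t / R⌋ : ℝ) * R)).symm.trans (A t))))
    (D' : Set ℝ) (hD'def : D' = D ∪ (⋃ n : ℕ, {t : ℝ | ¬ ∃ ε > 0, ContDiffOn ℝ n (uncurry v) (Icc (t - ε) (t + ε) ×ˢ univ)}) ∪
      {t : ℝ | ∃ j : ℤ, t = (j : ℝ) * R}) :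
    (∀ t z (k : d → ℤ), A' t (z + Torus.latticeVec k) = A' t z + Torus.latticeVec k) ∧
    (∀ (n : ℕ), 1 ≤ n → ∀ r, ∃ ε > 0, ContDiffOn ℝ n (fun p : ℝ × EuclideanSpace ℝ d => A' p.1 p.2) (Icc r (r + ε) ×ˢ univ) ∧
      ContDiffOn ℝ n (fun p : ℝ × EuclideanSpace ℝ d => A' p.1 p.2) (Icc (r - ε) r ×ˢ univ)) ∧
    (∀ (n : ℕ), 1 ≤ n → ∀ r, ∃ ε > 0, ContDiffOn ℝ n (fun p : ℝ × EuclideanSpace ℝ d => (A' p.1).symm p.2) (Icc r (r + ε) ×ˢ univ) ∧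
      ContDiffOn ℝ n (fun p : ℝ × EuclideanSpace ℝ d => (A' p.1).symm p.2) (Icc (r - ε) r ×ˢ univ)) ∧
    D'.Countable ∧
    (∀ (n : ℕ), 1 ≤ n → ∀ t ∉ D', ∃ ε > 0, ContDiffOn ℝ n (fun p : ℝ × EuclideanSpace ℝ d => A' p.1 p.2) (Icc (t - ε) (t + ε) ×ˢ univ)) ∧
    (∀ (n : ℕ), 1 ≤ n → ∀ t ∉ D', ∃ ε > 0, ContDiffOn ℝ n (fun p : ℝ × EuclideanSpace ℝ d => (A' p.1).symm p.2)
      (Icc (t - ε) (t + ε) ×ˢ univ)) ∧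
    (∀ t ∉ D', ∀ z, HasDerivAt (fun τ => A' τ z)
      (B t (A' t z) + fderiv ℝ (fun y => A t ((A ((⌊t / R⌋ : ℝ) * R)).symm y))
        (A ((⌊t / R⌋ : ℝ) * R) ((A t).symm (A' t z))) (v t (A ((⌊t / R⌋ : ℝ) * R) ((A t).symm (A' t z))))) t) ∧
    (∀ t z (k : d → ℤ), (B t (z + Torus.latticeVec k) + fderiv ℝ (fun y => A t ((A ((⌊t / R⌋ : ℝ) * R)).symm y))
        (A ((⌊t / R⌋ : ℝ) * R) ((A t).symm (z + Torus.latticeVec k)))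
        (v t (A ((⌊t / R⌋ : ℝ) * R) ((A t).symm (z + Torus.latticeVec k))))) =
      B t z + fderiv ℝ (fun y => A t ((A ((⌊t / R⌋ : ℝ) * R)).symm y))
        (A ((⌊t / R⌋ : ℝ) * R) ((A t).symm z)) (v t (A ((⌊t / R⌋ : ℝ) * R) ((A t).symm z)))) ∧
    (∀ a b : ℝ, ∃ C : ℝ, ∀ t ∈ Icc a b, ∀ z, ‖B t z + fderiv ℝ (fun y => A t ((A ((⌊t / R⌋ : ℝ) * R)).symm y))
        (A ((⌊t / R⌋ : ℝ) * R) ((A t).symm z)) (v t (A ((⌊t / R⌋ : ℝ) * R) ((A t).symm z)))‖ ≤ C) ∧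
    (∀ t ∉ D', ∀ z, ContinuousAt (uncurry fun t z => B t z + fderiv ℝ (fun y => A t ((A ((⌊t / R⌋ : ℝ) * R)).symm y))
        (A ((⌊t / R⌋ : ℝ) * R) ((A t).symm z)) (v t (A ((⌊t / R⌋ : ℝ) * R) ((A t).symm z)))) (t, z)) ∧
    (∀ a b : ℝ, ∃ K : ℝ, ∀ t ∈ Icc a b, ∀ z, ‖fderiv ℝ (A' t) z‖ ≤ K) ∧
    (∀ a b : ℝ, ∃ K : ℝ, ∀ t ∈ Icc a b, ∀ z, ‖fderiv ℝ (fun y => (A' t).symm y) z‖ ≤ K) := by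
  -- the given data: `Z` is the Eulerian evolution, `C` the accumulated window maps, `A'` the window formula, `D'` the breaks
  have hZself : ∀ t z, Z t t z = z := fun t z => by rw [hZ, evolutionMap_self]
  have hA'fun : A' = fun t => (C ⌊t / R⌋).trans ((Z t ((⌊t / R⌋ : ℝ) * R)).trans ((A ((⌊t / R⌋ : ℝ) * R)).symm.trans (A t))) :=
    funext hA'def
  subst hA'fun hD'def
  -- basic regularity of the factors
  have hAn : ∀ (n : ℕ), 1 ≤ n → ∀ t, ContDiff ℝ n (A t) ∧ ContDiff ℝ n (A t).symm := fun n hn t => by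
    obtain ⟨ε, hε, hR1, -⟩ := h3 n hn t
    obtain ⟨ε', hε', hR2, -⟩ := h3' n hn t
    exact ⟨hR1.comp_contDiff (contDiff_const.prodMk contDiff_id) fun _ => ⟨⟨le_rfl, by linarith⟩, mem_univ _⟩,
      hR2.comp_contDiff (contDiff_const.prodMk contDiff_id) fun _ => ⟨⟨le_rfl, by linarith⟩, mem_univ _⟩⟩
  have hA : ∀ t, ContDiff ℝ 1 (A t) ∧ ContDiff ℝ 1 (A t).symm := fun t => hAn 1 le_rfl t
  have hn' : ∀ {n : ℕ}, 1 ≤ n → (1 : ℕ∞) ≤ (n : ℕ∞) := fun hn => by exact_mod_cast hn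
  have hZcn : ∀ (n : ℕ), 1 ≤ n → ∀ t s, ContDiff ℝ n (Z t s) ∧ ContDiff ℝ n (Z t s).symm := fun n hn t s => by
    constructor
    · have e : ⇑(Z t s) = evolutionMap v s t := funext fun z => hZ t s z
      rw [e]; exact contDiff_evolutionMap_of_local hv (hn' hn) (hvloc n hn) s t
    · have e : ⇑(Z t s).symm = evolutionMap v t s := funext fun z => hZ' t s z
      rw [e]; exact contDiff_evolutionMap_of_local hv (hn' hn) (hvloc n hn) t s
  have hZc : ∀ t s, ContDiff ℝ 1 (Z t s) ∧ ContDiff ℝ 1 (Z t s).symm := hZcn 1 le_rfl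
  have hZeq : ∀ t s z (k : d → ℤ), Z t s (z + Torus.latticeVec k) = Z t s z + Torus.latticeVec k :=
    fun t s z k => by rw [hZ, hZ, evolutionMap_add_latticeVec hv hvper]
  have hMeq : ∀ (j : ℤ) z (k : d → ℤ), ((Z (((j : ℝ) + 1) * R) ((j : ℝ) * R)).trans
      ((A ((j : ℝ) * R)).symm.trans (A (((j : ℝ) + 1) * R)))) (z + Torus.latticeVec k) =
      ((Z (((j : ℝ) + 1) * R) ((j : ℝ) * R)).trans ((A ((j : ℝ) * R)).symm.trans (A (((j : ℝ) + 1) * R)))) z +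
        Torus.latticeVec k :=
    fun j z k => equivariant_trans (hZeq _ _) (equivariant_trans (equivariant_symm (h1 _)) (h1 _)) z k
  have hCeq := equivariant_chain C _ hC0 hC hMeq
  have hCcn : ∀ (n : ℕ), 1 ≤ n → ∀ j : ℤ, ContDiff ℝ n (C j) ∧ ContDiff ℝ n (C j).symm := fun n hn =>
    contDiff_chain_n C _ hC0 hC fun j => contDiff_trans_n (hZcn n hn _ _)
      (contDiff_trans_n (contDiff_symm_n (hAn n hn _)) (hAn n hn _))
  have hCc : ∀ j : ℤ, ContDiff ℝ 1 (C j) ∧ ContDiff ℝ 1 (C j).symm := hCcn 1 le_rfl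
  have hvc : Continuous (uncurry v) := by
    have h := hv.continuousOn_uncurry convex_univ
    rw [univ_prod_univ] at h
    exact continuousOn_univ.1 h
  -- the countable set of times without a two-sided smooth slab of `v`
  have hDv : (⋃ n : ℕ, {t : ℝ | ¬ ∃ ε > 0, ContDiffOn ℝ n (uncurry v) (Icc (t - ε) (t + ε) ×ˢ univ)}).Countable := by
    refine countable_iUnion fun n => countable_not_two_sided fun r => ?_
    obtain ⟨ε, hε, h₁, h₂⟩ := hvloc (max n 1) (le_max_right _ _) r
    have hle : (n : WithTop ℕ∞) ≤ ((max n 1 : ℕ) : WithTop ℕ∞) := by exact_mod_cast le_max_left n 1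
    exact ⟨ε, hε, h₁.of_le hle, h₂.of_le hle⟩
  -- THE NEW ABSOLUTE FLOW (explicit)
  refine ⟨?_, ?_, ?_, ?_, ?_, ?_, ?_, ?_, ?_, ?_, ?_, ?_⟩
  · -- lattice equivariance
    intro t z k
    exact equivariant_window_formula A Z (C ⌊t / R⌋) h1 hZeq (hCeq _) _ _ z k
  · -- one-sided slabs of `A'`
    intro n hn r
    obtain ⟨ε₁, hε₁, hr1⟩ := window_formula_eq_right A Z C R hR hZself hC r
    obtain ⟨ε₂, hε₂, hr2⟩ := window_formula_eq_left A Z C R hR hZself hC r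
    obtain ⟨ε₃, hε₃, hs1, -, -, -⟩ := exists_slabs_window_formula_n (hn' hn) hv (hvloc n hn) A (h3 n hn) (h3' n hn)
      (hAn n hn) (C ⌊r / R⌋) (hCcn n hn _) ((⌊r / R⌋ : ℝ) * R) r
    obtain ⟨ε₄, hε₄, -, hs2, -, -⟩ := exists_slabs_window_formula_n (hn' hn) hv (hvloc n hn) A (h3 n hn) (h3' n hn)
      (hAn n hn) (C (⌈r / R⌉ - 1)) (hCcn n hn _) (((⌈r / R⌉ - 1 : ℤ) : ℝ) * R) r
    refine ⟨min (min ε₁ ε₂) (min ε₃ ε₄), lt_min (lt_min hε₁ hε₂) (lt_min hε₃ hε₄), ?_, ?_⟩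
    · refine (hs1.mono (prod_mono (Icc_subset_Icc le_rfl (by
        linarith [min_le_right (min ε₁ ε₂) (min ε₃ ε₄), min_le_left ε₃ ε₄])) le_rfl)).congr fun p hp => ?_
      have hp1 : p.1 ∈ Icc r (r + ε₁) := ⟨hp.1.1, le_trans hp.1.2 (by
        linarith [min_le_left (min ε₁ ε₂) (min ε₃ ε₄), min_le_left ε₁ ε₂])⟩
      rw [hr1 p.1 hp1 p.2]
      exact (window_formula_apply A Z (C ⌊r / R⌋) hZ hZ' p.1 _ p.2).1
    · refine (hs2.mono (prod_mono (Icc_subset_Icc (by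
        linarith [min_le_right (min ε₁ ε₂) (min ε₃ ε₄), min_le_right ε₃ ε₄]) le_rfl) le_rfl)).congr fun p hp => ?_
      have hp1 : p.1 ∈ Icc (r - ε₂) r := ⟨le_trans (by
        linarith [min_le_left (min ε₁ ε₂) (min ε₃ ε₄), min_le_right ε₁ ε₂]) hp.1.1, hp.1.2⟩
      rw [hr2 p.1 hp1 p.2]
      exact (window_formula_apply A Z (C (⌈r / R⌉ - 1)) hZ hZ' p.1 _ p.2).1
  · -- one-sided slabs of the inverses
    intro n hn r
    obtain ⟨ε₁, hε₁, hr1⟩ := window_formula_eq_right A Z C R hR hZself hC r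
    obtain ⟨ε₂, hε₂, hr2⟩ := window_formula_eq_left A Z C R hR hZself hC r
    obtain ⟨ε₃, hε₃, -, -, hs1, -⟩ := exists_slabs_window_formula_n (hn' hn) hv (hvloc n hn) A (h3 n hn) (h3' n hn)
      (hAn n hn) (C ⌊r / R⌋) (hCcn n hn _) ((⌊r / R⌋ : ℝ) * R) r
    obtain ⟨ε₄, hε₄, -, -, -, hs2⟩ := exists_slabs_window_formula_n (hn' hn) hv (hvloc n hn) A (h3 n hn) (h3' n hn)
      (hAn n hn) (C (⌈r / R⌉ - 1)) (hCcn n hn _) (((⌈r / R⌉ - 1 : ℤ) : ℝ) * R) r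
    refine ⟨min (min ε₁ ε₂) (min ε₃ ε₄), lt_min (lt_min hε₁ hε₂) (lt_min hε₃ hε₄), ?_, ?_⟩
    · refine (hs1.mono (prod_mono (Icc_subset_Icc le_rfl (by
        linarith [min_le_right (min ε₁ ε₂) (min ε₃ ε₄), min_le_left ε₃ ε₄])) le_rfl)).congr fun p hp => ?_
      have hp1 : p.1 ∈ Icc r (r + ε₁) := ⟨hp.1.1, le_trans hp.1.2 (by
        linarith [min_le_left (min ε₁ ε₂) (min ε₃ ε₄), min_le_left ε₁ ε₂])⟩
      have hE : (C ⌊p.1 / R⌋).trans ((Z p.1 ((⌊p.1 / R⌋ : ℝ) * R)).trans ((A ((⌊p.1 / R⌋ : ℝ) * R)).symm.trans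
          (A p.1))) = (C ⌊r / R⌋).trans ((Z p.1 ((⌊r / R⌋ : ℝ) * R)).trans ((A ((⌊r / R⌋ : ℝ) * R)).symm.trans
          (A p.1))) := Equiv.ext fun z => hr1 p.1 hp1 z
      simp only []
      rw [hE]
      exact (window_formula_apply A Z (C ⌊r / R⌋) hZ hZ' p.1 _ p.2).2
    · refine (hs2.mono (prod_mono (Icc_subset_Icc (by
        linarith [min_le_right (min ε₁ ε₂) (min ε₃ ε₄), min_le_right ε₃ ε₄]) le_rfl) le_rfl)).congr fun p hp => ?_
      have hp1 : p.1 ∈ Icc (r - ε₂) r := ⟨le_trans (by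
        linarith [min_le_left (min ε₁ ε₂) (min ε₃ ε₄), min_le_right ε₁ ε₂]) hp.1.1, hp.1.2⟩
      have hE : (C ⌊p.1 / R⌋).trans ((Z p.1 ((⌊p.1 / R⌋ : ℝ) * R)).trans ((A ((⌊p.1 / R⌋ : ℝ) * R)).symm.trans
          (A p.1))) = (C (⌈r / R⌉ - 1)).trans ((Z p.1 (((⌈r / R⌉ - 1 : ℤ) : ℝ) * R)).trans
          ((A (((⌈r / R⌉ - 1 : ℤ) : ℝ) * R)).symm.trans (A p.1))) := Equiv.ext fun z => hr2 p.1 hp1 z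
      simp only []
      rw [hE]
      exact (window_formula_apply A Z (C (⌈r / R⌉ - 1)) hZ hZ' p.1 _ p.2).2
  · -- countable break times
    exact (h4.union hDv).union (countable_window_boundaries R)
  · -- two-sided slabs of `A'` off the break times
    intro n hn t ht
    have htD : t ∉ D := fun h => ht (Or.inl (Or.inl h))
    have hvt : ∃ ε > 0, ContDiffOn ℝ n (uncurry v) (Icc (t - ε) (t + ε) ×ˢ univ) := by
      by_contra h; exact ht (Or.inl (Or.inr (mem_iUnion.2 ⟨n, h⟩)))
    have htb : ∀ j : ℤ, t ≠ (j : ℝ) * R := fun j hj => ht (Or.inr ⟨j, hj⟩)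
    obtain ⟨ε₁, hε₁, hr1⟩ := window_formula_eq_two_sided A Z C R hR hZself hC (t := t) htb
    obtain ⟨ε₂, hε₂, hs1, -⟩ := exists_two_sided_slab_window_formula_n (hn' hn) hv (hvloc n hn) A (hAn n hn) (C ⌊t / R⌋)
      (hCcn n hn _) ((⌊t / R⌋ : ℝ) * R) hvt (h4a n hn t htD) (h4b n hn t htD)
    refine ⟨min ε₁ ε₂, lt_min hε₁ hε₂, (hs1.mono (prod_mono (Icc_subset_Icc (by linarith [min_le_right ε₁ ε₂])
      (by linarith [min_le_right ε₁ ε₂])) le_rfl)).congr fun p hp => ?_⟩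
    have hp1 : p.1 ∈ Icc (t - ε₁) (t + ε₁) :=
      ⟨le_trans (by linarith [min_le_left ε₁ ε₂]) hp.1.1, le_trans hp.1.2 (by linarith [min_le_left ε₁ ε₂])⟩
    rw [hr1 p.1 hp1 p.2]
    exact (window_formula_apply A Z (C ⌊t / R⌋) hZ hZ' p.1 _ p.2).1
  · -- two-sided slabs of the inverses off the break times
    intro n hn t ht
    have htD : t ∉ D := fun h => ht (Or.inl (Or.inl h))
    have hvt : ∃ ε > 0, ContDiffOn ℝ n (uncurry v) (Icc (t - ε) (t + ε) ×ˢ univ) := by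
      by_contra h; exact ht (Or.inl (Or.inr (mem_iUnion.2 ⟨n, h⟩)))
    have htb : ∀ j : ℤ, t ≠ (j : ℝ) * R := fun j hj => ht (Or.inr ⟨j, hj⟩)
    obtain ⟨ε₁, hε₁, hr1⟩ := window_formula_eq_two_sided A Z C R hR hZself hC (t := t) htb
    obtain ⟨ε₂, hε₂, -, hs1⟩ := exists_two_sided_slab_window_formula_n (hn' hn) hv (hvloc n hn) A (hAn n hn) (C ⌊t / R⌋)
      (hCcn n hn _) ((⌊t / R⌋ : ℝ) * R) hvt (h4a n hn t htD) (h4b n hn t htD)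
    refine ⟨min ε₁ ε₂, lt_min hε₁ hε₂, (hs1.mono (prod_mono (Icc_subset_Icc (by linarith [min_le_right ε₁ ε₂])
      (by linarith [min_le_right ε₁ ε₂])) le_rfl)).congr fun p hp => ?_⟩
    have hp1 : p.1 ∈ Icc (t - ε₁) (t + ε₁) :=
      ⟨le_trans (by linarith [min_le_left ε₁ ε₂]) hp.1.1, le_trans hp.1.2 (by linarith [min_le_left ε₁ ε₂])⟩
    have hE : (C ⌊p.1 / R⌋).trans ((Z p.1 ((⌊p.1 / R⌋ : ℝ) * R)).trans ((A ((⌊p.1 / R⌋ : ℝ) * R)).symm.trans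
        (A p.1))) = (C ⌊t / R⌋).trans ((Z p.1 ((⌊t / R⌋ : ℝ) * R)).trans ((A ((⌊t / R⌋ : ℝ) * R)).symm.trans
        (A p.1))) := Equiv.ext fun z => hr1 p.1 hp1 z
    simp only []
    rw [hE]
    exact (window_formula_apply A Z (C ⌊t / R⌋) hZ hZ' p.1 _ p.2).2
  · -- the flow equation off the break times
    intro t ht z
    have htD : t ∉ D := fun h => ht (Or.inl (Or.inl h))
    have htb : ∀ j : ℤ, t ≠ (j : ℝ) * R := fun j hj => ht (Or.inr ⟨j, hj⟩)
    obtain ⟨ε₁, hε₁, hr1⟩ := window_formula_eq_two_sided A Z C R hR hZself hC (t := t) htb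
    set s : ℝ := (⌊t / R⌋ : ℝ) * R with hs
    have hder := hasDerivAt_window_formula hv A B s (C ⌊t / R⌋) z (h4a 1 le_rfl t htD) (h5 t htD) (hA t).1 (hA s).2
    -- the value of `A' t z` and of the frame point
    have hP : ((C ⌊t / R⌋).trans ((Z t s).trans ((A s).symm.trans (A t)))) z =
        A t ((A s).symm (evolutionMap v s t (C ⌊t / R⌋ z))) := (window_formula_apply A Z (C ⌊t / R⌋) hZ hZ' t s z).1
    have hq : A s ((A t).symm (((C ⌊t / R⌋).trans ((Z t s).trans ((A s).symm.trans (A t)))) z)) =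
        evolutionMap v s t (C ⌊t / R⌋ z) := by
      rw [hP]; simp
    simp only []
    rw [hq, hP]
    refine hder.congr_of_eventuallyEq ?_
    filter_upwards [Icc_mem_nhds (show t - ε₁ < t by linarith) (show t < t + ε₁ by linarith)] with τ hτ
    rw [hr1 τ hτ z]
    exact (window_formula_apply A Z (C ⌊t / R⌋) hZ hZ' τ s z).1
  · -- periodicity of the new velocity
    intro t z k
    rw [h7a, inserted_add_latticeVec A v t _ h1 hvper]
  · -- local boundedness of the new velocity
    intro a b
    obtain ⟨C₀, hC₀⟩ := h7b a b
    obtain ⟨K₁, hK₁⟩ := h8 a b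
    obtain ⟨K₂, hK₂⟩ := h8' (a - R) b
    obtain ⟨Cv, hCv⟩ := hvbdd
    refine ⟨C₀ + max K₁ 0 * max K₂ 0 * max Cv 0, fun t ht z => ?_⟩
    have hsI : (⌊t / R⌋ : ℝ) * R ∈ Icc (a - R) b := by
      obtain ⟨h1', h2'⟩ := floor_window hR t
      exact ⟨by nlinarith [ht.1], le_trans h1' ht.2⟩
    have hb := norm_inserted_le A t ((⌊t / R⌋ : ℝ) * R) (hA t).1 (hA _).2
      (K₁ := max K₁ 0) (K₂ := max K₂ 0) (fun y => (hK₁ t ht y).trans (le_max_left _ _))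
      (fun y => (hK₂ _ hsI y).trans (le_max_left _ _)) (le_max_right _ _)
      (A ((⌊t / R⌋ : ℝ) * R) ((A t).symm z)) (v t (A ((⌊t / R⌋ : ℝ) * R) ((A t).symm z)))
    calc _ ≤ ‖B t z‖ + ‖fderiv ℝ (fun y => A t ((A ((⌊t / R⌋ : ℝ) * R)).symm y)) (A ((⌊t / R⌋ : ℝ) * R) ((A t).symm z))
          (v t (A ((⌊t / R⌋ : ℝ) * R) ((A t).symm z)))‖ := norm_add_le _ _
      _ ≤ C₀ + max K₁ 0 * max K₂ 0 * ‖v t (A ((⌊t / R⌋ : ℝ) * R) ((A t).symm z))‖ := add_le_add (hC₀ t ht z) hb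
      _ ≤ C₀ + max K₁ 0 * max K₂ 0 * max Cv 0 := by
          have : ‖v t (A ((⌊t / R⌋ : ℝ) * R) ((A t).symm z))‖ ≤ max Cv 0 := (hCv _ _).trans (le_max_left _ _)
          have h0 : 0 ≤ max K₁ 0 * max K₂ 0 := mul_nonneg (le_max_right _ _) (le_max_right _ _)
          nlinarith
  · -- joint continuity of the new velocity off the break times
    intro t ht z
    have htD : t ∉ D := fun h => ht (Or.inl (Or.inl h))
    have htb : ∀ j : ℤ, t ≠ (j : ℝ) * R := fun j hj => ht (Or.inr ⟨j, hj⟩)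
    obtain ⟨ε₁, hε₁, hsub⟩ := exists_Icc_subset_Ioo_window hR (t := t) htb
    have hB := h7c t htD z
    have hI := continuousAt_inserted A v ((⌊t / R⌋ : ℝ) * R) z (h4a 1 le_rfl t htD) (h4b 1 le_rfl t htD)
      (fun τ => (hA τ).1) (hA _).2 hvc
    refine (hB.add hI).congr ?_
    have hnhds : Icc (t - ε₁) (t + ε₁) ×ˢ (univ : Set (EuclideanSpace ℝ d)) ∈ 𝓝 (t, z) :=
      prod_mem_nhds (Icc_mem_nhds (by linarith) (by linarith)) univ_mem
    filter_upwards [hnhds] with p hp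
    have hfl : ⌊p.1 / R⌋ = ⌊t / R⌋ := floor_eq_of_mem_Ico hR (Ioo_subset_Ico_self (hsub hp.1))
    simp only [Pi.add_apply, uncurry, hfl]
  · -- derivative bounds for `A'` on compact time ranges
    intro a b
    obtain ⟨K₁, hK₁⟩ := h8 a b
    obtain ⟨K₂, hK₂⟩ := h8' (a - R) b
    obtain ⟨K₃, hK₃0, hK₃⟩ := exists_bound_fderiv_evolutionMap_Icc hv (a - R) b
    choose KC hKC using fun j : ℤ => exists_bound_fderiv_of_equivariant (hCc j).1 (hCeq j)
    refine ⟨max K₁ 0 * max K₂ 0 * K₃ * ∑ j ∈ Finset.Icc ⌊a / R⌋ ⌊b / R⌋, max (KC j) 0, fun t ht z => ?_⟩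
    have hsI : (⌊t / R⌋ : ℝ) * R ∈ Icc (a - R) b := by
      obtain ⟨h1', h2'⟩ := floor_window hR t
      exact ⟨by nlinarith [ht.1], le_trans h1' ht.2⟩
    have htI : t ∈ Icc (a - R) b := ⟨by linarith [ht.1], ht.2⟩
    have hjI : ⌊t / R⌋ ∈ Finset.Icc ⌊a / R⌋ ⌊b / R⌋ := by
      rw [Finset.mem_Icc]
      exact ⟨Int.floor_le_floor (div_le_div_of_nonneg_right ht.1 hR.le),
        Int.floor_le_floor (div_le_div_of_nonneg_right ht.2 hR.le)⟩
    have hKC' : ∀ y, ‖fderiv ℝ (C ⌊t / R⌋) y‖ ≤ ∑ j ∈ Finset.Icc ⌊a / R⌋ ⌊b / R⌋, max (KC j) 0 := fun y =>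
      ((hKC _ y).trans (le_max_left _ 0)).trans
        (Finset.single_le_sum (f := fun j => max (KC j) 0) (fun j _ => le_max_right _ _) hjI)
    have e : ⇑((C ⌊t / R⌋).trans ((Z t ((⌊t / R⌋ : ℝ) * R)).trans ((A ((⌊t / R⌋ : ℝ) * R)).symm.trans (A t)))) =
        fun y => A t ((A ((⌊t / R⌋ : ℝ) * R)).symm (evolutionMap v ((⌊t / R⌋ : ℝ) * R) t (C ⌊t / R⌋ y))) :=
      funext fun y => (window_formula_apply A Z (C ⌊t / R⌋) hZ hZ' t _ y).1
    simp only []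
    rw [e]
    exact norm_fderiv_comp4_le (A t) (A ((⌊t / R⌋ : ℝ) * R)).symm (evolutionMap v ((⌊t / R⌋ : ℝ) * R) t)
      (C ⌊t / R⌋) (hA t).1 (hA _).2 (contDiff_evolutionMap_of_local hv le_rfl (hvloc 1 le_rfl) _ _) (hCc _).1
      (fun y => (hK₁ t ht y).trans (le_max_left _ _)) (fun y => (hK₂ _ hsI y).trans (le_max_left _ _))
      (fun y => hK₃ _ hsI _ htI y) hKC' (le_max_right _ _) (le_max_right _ _) hK₃0 z
  · -- derivative bounds for the inverses
    intro a b
    obtain ⟨K₁, hK₁⟩ := h8' a b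
    obtain ⟨K₂, hK₂⟩ := h8 (a - R) b
    obtain ⟨K₃, hK₃0, hK₃⟩ := exists_bound_fderiv_evolutionMap_Icc hv (a - R) b
    choose KC hKC using fun j : ℤ => exists_bound_fderiv_of_equivariant (hCc j).2 (equivariant_symm (hCeq j))
    refine ⟨(∑ j ∈ Finset.Icc ⌊a / R⌋ ⌊b / R⌋, max (KC j) 0) * K₃ * max K₂ 0 * max K₁ 0, fun t ht z => ?_⟩
    have hsI : (⌊t / R⌋ : ℝ) * R ∈ Icc (a - R) b := by
      obtain ⟨h1', h2'⟩ := floor_window hR t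
      exact ⟨by nlinarith [ht.1], le_trans h1' ht.2⟩
    have htI : t ∈ Icc (a - R) b := ⟨by linarith [ht.1], ht.2⟩
    have hjI : ⌊t / R⌋ ∈ Finset.Icc ⌊a / R⌋ ⌊b / R⌋ := by
      rw [Finset.mem_Icc]
      exact ⟨Int.floor_le_floor (div_le_div_of_nonneg_right ht.1 hR.le),
        Int.floor_le_floor (div_le_div_of_nonneg_right ht.2 hR.le)⟩
    have hKC' : ∀ y, ‖fderiv ℝ (C ⌊t / R⌋).symm y‖ ≤ ∑ j ∈ Finset.Icc ⌊a / R⌋ ⌊b / R⌋, max (KC j) 0 := fun y =>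
      ((hKC _ y).trans (le_max_left _ 0)).trans
        (Finset.single_le_sum (f := fun j => max (KC j) 0) (fun j _ => le_max_right _ _) hjI)
    have e : (fun y => ((C ⌊t / R⌋).trans ((Z t ((⌊t / R⌋ : ℝ) * R)).trans ((A ((⌊t / R⌋ : ℝ) * R)).symm.trans
        (A t)))).symm y) =
        fun y => (C ⌊t / R⌋).symm (evolutionMap v t ((⌊t / R⌋ : ℝ) * R) (A ((⌊t / R⌋ : ℝ) * R) ((A t).symm y))) :=
      funext fun y => (window_formula_apply A Z (C ⌊t / R⌋) hZ hZ' t _ y).2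
    simp only []
    rw [e]
    have hsum0 : 0 ≤ ∑ j ∈ Finset.Icc ⌊a / R⌋ ⌊b / R⌋, max (KC j) 0 :=
      Finset.sum_nonneg fun j _ => le_max_right _ _
    exact norm_fderiv_comp4_le (C ⌊t / R⌋).symm (evolutionMap v t ((⌊t / R⌋ : ℝ) * R)) (A ((⌊t / R⌋ : ℝ) * R))
      (fun y => (A t).symm y) (hCc _).2 (contDiff_evolutionMap_of_local hv le_rfl (hvloc 1 le_rfl) _ _) (hA _).1 (hA t).2
      hKC' (fun y => hK₃ _ htI _ hsI y) (fun y => (hK₂ _ hsI y).trans (le_max_left _ _))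
      (fun y => (hK₁ t ht y).trans (le_max_left _ _)) hsum0 hK₃0 (le_max_right _ _) z

end Step

end Summit.AnomalousDissipation.AnomalousDissipation.Theorems.SolenoidalFractalHomogenisation.LagrangianCarrierConstruction

end
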